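import Summits.ValiantsHypothesis.ValiantsHypothesis.Theses.MonotoneRestoration
import Summits.ValiantsHypothesis.ValiantsHypothesis.Theorems.MonotoneRestorationQP.Negative.LoadBearing

/-!
# ValiantsHypothesis / MonotoneRestoration — `Assembly` (item stmt-ValiantsHypothesis-16248)

The assembly item of route `MonotoneRestoration`:

  `Assembly := NonnegRestorationQP → ValiantsHypothesis` (`VP_ℂ ≠ VNP_ℂ`),

which is exactly the type of the route file's sorry-free deciding theorem `closes`
(per ∈ VNP; under VP = VNP the nonnegative permanent is a matrix-symmetric VP family, so
`NonnegRestorationQP` gives it square-symmetric circuits of size `2^((log₂ n + c)^c)`;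
Dawar–Wilsenach 2025 Thm 7.1, proved in the tree, gives `2^(δ n)` infinitely often;
polylog-versus-linear arithmetic). Re-filed under `Theorems` so that the item closes by name.

Maintenance note (full-build repair 2026-08-16): since route rev 9 the deciding theorem `closes` takes
the four route items `MonotoneRestorationQP`, `SensitiveBridge`, `DenseSubtraction`, `CruxToTarget`
as hypotheses and proves `Assembly` only internally (a `have`), so `fun h => closes h` no longer
type-checks. The statement is unchanged; the proof below is Step 2 of `closes` written out against
the tree lemmas `not_qpSymmetric_perPoly` (Dawar–Wilsenach Thm 7.1, size form, at the nonnegative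
permanent) and `rename_perm_perPoly` of `Theorems/MonotoneRestorationQP/Negative/LoadBearing.lean`.
-/

-- `Summit.ValiantsHypothesis.ValiantsHypothesis.…` is the tree's mandated single-conjunct layout
-- (Sub = Summit), so the duplicated namespace component is intended.
set_option linter.dupNamespace false

namespace Summit.ValiantsHypothesis.ValiantsHypothesis.Theorems

open Summit.ValiantsHypothesis.ValiantsHypothesis.Theses.MonotoneRestoration

/-- **Assembly** (item stmt-ValiantsHypothesis-16248 of route MonotoneRestoration):
nonnegative restoration at quasi-polynomial cost (`NonnegRestorationQP`) implies Valiant's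
hypothesis `VP ℂ ≠ VNP ℂ`. Proof (Step 2 of the route's deciding theorem): if `VP ℂ = VNP ℂ` then
the permanent family is a VP family (`perFamily_mem_VNP_holds`, `mem_VP_ofFintype_iff_holds`); the
nonnegative permanent `perPoly (Fin n) ℝ≥0` is matrix-symmetric (`rename_perm_perPoly`) and its
complexification is that VP family (`map_perPoly`), so `NonnegRestorationQP` gives it
square-symmetric circuits of size `2^((log₂ n + c)^c)` — impossible by Dawar–Wilsenach 2025
Thm 7.1 (`not_qpSymmetric_perPoly`). [cite: DawarWilsenach2025, Thm. 7.1] -/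
theorem monotoneRestorationAssembly_proof :
    Summit.ValiantsHypothesis.ValiantsHypothesis.Theses.MonotoneRestoration.Assembly := by
  intro hX
  classical
  show Literature.Computability.AlgebraicComplexity.VP ℂ ≠
    Literature.Computability.AlgebraicComplexity.VNP ℂ
  intro hEq
  -- VP = VNP puts the permanent family in VP (Valiant: per ∈ VNP, proved in the tree)
  have hVP : Literature.Computability.AlgebraicComplexity.IsVPFamily
      (fun n => Literature.Computability.AlgebraicComplexity.perPoly (Fin n) ℂ) := by
    have hper : Literature.Computability.AlgebraicComplexity.perFamily ℂ ∈
        Literature.Computability.AlgebraicComplexity.VP ℂ := by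
      rw [hEq]; exact Literature.Computability.AlgebraicComplexity.perFamily_mem_VNP_holds ℂ
    exact (Literature.Computability.AlgebraicComplexity.mem_VP_ofFintype_iff_holds _).1 hper
  -- the complexification of the nonnegative permanent is that family
  have hVP' : Literature.Computability.AlgebraicComplexity.IsVPFamily
      (fun n => MvPolynomial.map (Complex.ofRealHom.comp NNReal.toRealHom)
        (Literature.Computability.AlgebraicComplexity.perPoly (Fin n) NNReal)) := by
    have : (fun n => MvPolynomial.map (Complex.ofRealHom.comp NNReal.toRealHom)
        (Literature.Computability.AlgebraicComplexity.perPoly (Fin n) NNReal)) =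
        (fun n => Literature.Computability.AlgebraicComplexity.perPoly (Fin n) ℂ) :=
      funext fun n => Literature.Computability.AlgebraicComplexity.map_perPoly _
    rw [this]; exact hVP
  -- nonnegative restoration at the (matrix-symmetric) permanent contradicts Dawar–Wilsenach Thm 7.1
  exact MonotoneRestorationQP.Negative.not_qpSymmetric_perPoly
    (hX (fun n => Literature.Computability.AlgebraicComplexity.perPoly (Fin n) NNReal)
      MonotoneRestorationQP.Negative.rename_perm_perPoly hVP')

end Summit.ValiantsHypothesis.ValiantsHypothesis.Theorems
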